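/-
Copyright (c) 2026 the pub-hodgecm-mathlib formalisation cell (harness21).  Prover seat hodgecm-mathlib-K2Liu-p10 (g0), Track B «K2-LIT»,
#184♮ = hLiu418 = `stmt-HodgeConjecture-24832`; LEAD F0P6-plan (g11) RE-POINT 2026-09-04T05:28:07Z of req649 (S3) + GO 05:35:04Z «§1 as its own file FIRST»: #33b (a), file (G) —
the GENERIC topological half of the main-orbit chart — `P_Δ × G → H = U(J ⊕ −J)`, `(P, A) ↦ P·ι(A, 1)`, is an open embedding onto
`Ω = {M(B) unit}` over any topological commutative ring whose units form an open set on which inversion is continuous.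
-/
import Summits.HodgeConjecture.HodgeConjecture.Theorems.K2LiuDoublingMainOrbitBlocksRing   -- ★ (A′) p857600 (+ ★ (A) p857583 §1): the block ALGEBRA of the main orbit
import Literature.NumberTheory.Automorphic.UnitaryGroupDirectSum                           -- ★ `unitaryGroupOfForm`, `UnitaryGroup.blockDiag`, `coe_blockDiag`, `continuous_blockDiag`
import Mathlib.Topology.Instances.Matrix
import Mathlib.Topology.Algebra.Group.Pointwise
import HarnessLib

/-!
# Crux `HLiu418`, road `K2_Liu`, socket #33b organ (a), file (G) «Generic»: the main-orbit chart `P_Δ × G ≅ Ω ⊆ H` is an OPEN EMBEDDING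
# (generic topological commutative ring; consumed by file (B) at the finite places and by file (C) at the archimedean place)

Cell `hodgecm-mathlib`, crux item hLiu418 = `stmt-HodgeConjecture-24832`; squad K2, LEAD F0P6-plan (g11), box K2E5-r01 (g6), consumer K2E2-p12 (g3)
(#33b (D) + assembly), twins K2Liu-p08 (g0) (finite place, file (B)) and this seat's file (C) (archimedean place).  THEOREMS ONLY (no `def`, no
instance, no notation, no named-fact hypothesis, no `sorry`); lane `--supports stmt-HodgeConjecture-24832 --as helper` (count-neutral helper).

SETTING.  `R` a commutative TOPOLOGICAL ring with a ring endomorphism `σ`, `J ∈ M_ι(R)`; the doubled form `J ⊕ −J = fromBlocks J 0 0 (−J)` on `ι ⊕ ι`;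
`H := unitaryGroupOfForm σ (J ⊕ −J) ≤ GL_{ι ⊕ ι}(R)` (★ `unitaryGroupOfForm`), `G := unitaryGroupOfForm σ J ≤ GL_ι(R)`, the Siegel SUBTYPE
`P_Δ := {P : H // P₁₁ + P₁₂ = P₂₁ + P₂₂}` (stabiliser of the diagonal), the embedding `ι(A, 1) := ★ UnitaryGroup.blockDiag σ J (−J) (A, 1)`
(matrix `fromBlocks A 0 0 1`, ★ `coe_blockDiag` `rfl`), and `M(B) := B₂₂ − B₁₂`, `A(B) := M(B)⁻¹(B₁₁ − B₂₁)` (both spelled out).  All topologies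
are the subspace topologies from `GL = (Matrix)ˣ` (Mathlib's `Units` topology); products carry the product topology.

RESULTS (★ (A′) `K2LiuDoublingMainOrbitBlocksRing` supplies all the algebra: `siegel_mul_iota_unique_ring`, `unitary_mainOrbitBlock_ring`,
`isUnit_mainOrbitBlock_ring`, `siegel_of_mainOrbit_block_ring`; this file adds ONLY topology and the `GL`-packaging):
* §1 matrix-level continuity: the four blocks, `M`, and — at a point where `M(B)` is a unit and `Ring.inverse` is continuous at units (`hinv`) — the
  rational coordinate `A(B)` and its inverse (Mathlib `continuousAt_matrix_inv`);
* §2 the chart `m : P_Δ × G → H`, `m(P, A) = P·ι(A,1)`: its matrix, INJECTIVITY (`siegel_mul_blockDiag_injective`), `M ∘ m` is a unit; for `IsUnit J.det`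
  the coordinates of `B ∈ Ω := {B : H | M(B) unit}` — `A(B) ∈ G` (`nonsingInvUnit_mainOrbitBlock_mem`), `B·ι(A(B),1)⁻¹ ∈ P_Δ` (`siegel_mul_blockDiag_inv`) —
  and the RANGE `= Ω` (`range_siegel_mul_blockDiag`);
* §3 topology: `Ω` is OPEN when the units of `R` are (`hU`; `isOpen_setOf_isUnit_mainOrbitBlock`), the two coordinates are CONTINUOUS on `Ω`
  (`continuous_mainOrbitBlockUnit`, `continuous_siegelFactor`), `m` is an open map and an OPEN EMBEDDING (`isOpenEmbedding_siegel_mul_blockDiag`);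
* §4 (D1) for `R` Hausdorff: `P_Δ` is closed and `m(P_Δ × C) = P_Δ · ι(C, 1)` is CLOSED for `C ⊆ G` compact (`IsClosed.mul_right_of_isCompact`).
The hypotheses `hU : IsOpen {x : R | IsUnit x}` and `hinv : ∀ x, IsUnit x → ContinuousAt Ring.inverse x` are taken BY VALUE; they hold for every complete
normed ring (`Units.isOpen`, `NormedRing.inverse_continuousAt`: the archimedean carrier `L ⊗ ℝ`, file (C)) and for finite products of topological fields
with continuous inversion (the local carrier `Π_{w ∣ v} L_w`, file (B)).
[GelbartPiatetskishapiroRallis1987, Part A §1 (the `G × G`-orbits on `P\H`; the main orbit is open with stabiliser `G^Δ`)] [Liu2021, §B.3 (B.5), Lem. B.11]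
[HarrisKudlaSweet1996, §1 (1.11)–(1.12)].
HONEST LABEL.  Count-neutral helper; `HC_CM` is proved only modulo the 7 printed citations (2 remaining named inputs: hLiu418 = `stmt-HodgeConjecture-24832`,
h413 = `stmt-HodgeConjecture-24833`) until rung 0 closes.
-/

set_option autoImplicit false
set_option linter.dupNamespace false -- the mandated namespace repeats `HodgeConjecture.HodgeConjecture`

namespace Summit.HodgeConjecture.HodgeConjecture.Cruxes.HLiu418.K2LiuSiegelMainOrbitOpenEmbeddingGeneric

open Matrix Topology Set Filter
open scoped Pointwise
open Literature.NumberTheory.Automorphic Literature.NumberTheory.Automorphic.UnitaryGroup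
open Summit.HodgeConjecture.HodgeConjecture.Cruxes.HLiu418.K2LiuDoublingMainOrbitBlocksUnit
open Summit.HodgeConjecture.HodgeConjecture.Cruxes.HLiu418.K2LiuDoublingMainOrbitBlocksRing

variable {R : Type*} [CommRing R] (σ : R →+* R) {ι : Type*} [Fintype ι] [DecidableEq ι] (J : Matrix ι ι R)

/-! ## §1 Matrix-level continuity -/

section MatrixLevel

variable [TopologicalSpace R] [IsTopologicalRing R]

omit [CommRing R] [IsTopologicalRing R] [Fintype ι] [DecidableEq ι] in
/-- the four blocks of a `2 × 2` block matrix depend continuously on it. [folklore] -/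
theorem continuous_toBlocks :
    (Continuous fun B : Matrix (ι ⊕ ι) (ι ⊕ ι) R => B.toBlocks₁₁) ∧ (Continuous fun B : Matrix (ι ⊕ ι) (ι ⊕ ι) R => B.toBlocks₁₂) ∧
      (Continuous fun B : Matrix (ι ⊕ ι) (ι ⊕ ι) R => B.toBlocks₂₁) ∧ (Continuous fun B : Matrix (ι ⊕ ι) (ι ⊕ ι) R => B.toBlocks₂₂) :=
  ⟨continuous_matrix fun i j => continuous_id.matrix_elem (Sum.inl i) (Sum.inl j),
    continuous_matrix fun i j => continuous_id.matrix_elem (Sum.inl i) (Sum.inr j),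
    continuous_matrix fun i j => continuous_id.matrix_elem (Sum.inr i) (Sum.inl j),
    continuous_matrix fun i j => continuous_id.matrix_elem (Sum.inr i) (Sum.inr j)⟩

omit [Fintype ι] [DecidableEq ι] in
/-- `B ↦ M(B) = B₂₂ − B₁₂` is continuous. [folklore] -/
theorem continuous_toBlocks_sub : Continuous fun B : Matrix (ι ⊕ ι) (ι ⊕ ι) R => B.toBlocks₂₂ - B.toBlocks₁₂ :=
  continuous_toBlocks.2.2.2.sub continuous_toBlocks.2.1

omit [Fintype ι] [DecidableEq ι] in
/-- `B ↦ B₁₁ − B₂₁` is continuous. [folklore] -/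
theorem continuous_toBlocks_sub' : Continuous fun B : Matrix (ι ⊕ ι) (ι ⊕ ι) R => B.toBlocks₁₁ - B.toBlocks₂₁ :=
  continuous_toBlocks.1.sub continuous_toBlocks.2.2.1

/-- matrix inversion `X ↦ X⁻¹` is continuous at every invertible matrix, provided `Ring.inverse` is continuous at the units of `R`
(Mathlib's `continuousAt_matrix_inv`). [folklore] -/
theorem continuousAt_inv_of_isUnit (hinv : ∀ x : R, IsUnit x → ContinuousAt Ring.inverse x) {κ : Type*} [Fintype κ] [DecidableEq κ]
    (X : Matrix κ κ R) (hX : IsUnit X) : ContinuousAt Inv.inv X :=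
  continuousAt_matrix_inv X (hinv _ ((isUnit_iff_isUnit_det X).1 hX))

/-- **the rational coordinate `B ↦ A(B) = M(B)⁻¹(B₁₁ − B₂₁)` is continuous at every `B` with `M(B)` a unit.** [cite: Liu2021, Lem. B.11 p. 102] -/
theorem continuousAt_mainOrbitBlock (hinv : ∀ x : R, IsUnit x → ContinuousAt Ring.inverse x) (B : Matrix (ι ⊕ ι) (ι ⊕ ι) R)
    (hM : IsUnit (B.toBlocks₂₂ - B.toBlocks₁₂)) :
    ContinuousAt (fun B : Matrix (ι ⊕ ι) (ι ⊕ ι) R => (B.toBlocks₂₂ - B.toBlocks₁₂)⁻¹ * (B.toBlocks₁₁ - B.toBlocks₂₁)) B := by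
  have h1 : ContinuousAt (fun B : Matrix (ι ⊕ ι) (ι ⊕ ι) R => (B.toBlocks₂₂ - B.toBlocks₁₂)⁻¹) B :=
    ContinuousAt.comp (g := fun X : Matrix ι ι R => X⁻¹) (f := fun B : Matrix (ι ⊕ ι) (ι ⊕ ι) R => B.toBlocks₂₂ - B.toBlocks₁₂)
      (continuousAt_inv_of_isUnit hinv _ hM) continuous_toBlocks_sub.continuousAt
  exact h1.mul continuous_toBlocks_sub'.continuousAt

/-- the inverse coordinate `B ↦ A(B)⁻¹` is continuous at every `B` with `M(B)` a unit and `A(B)` invertible. [cite: Liu2021, Lem. B.11 p. 102] -/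
theorem continuousAt_mainOrbitBlock_inv (hinv : ∀ x : R, IsUnit x → ContinuousAt Ring.inverse x) (B : Matrix (ι ⊕ ι) (ι ⊕ ι) R)
    (hM : IsUnit (B.toBlocks₂₂ - B.toBlocks₁₂)) (hA : IsUnit ((B.toBlocks₂₂ - B.toBlocks₁₂)⁻¹ * (B.toBlocks₁₁ - B.toBlocks₂₁))) :
    ContinuousAt (fun B : Matrix (ι ⊕ ι) (ι ⊕ ι) R => ((B.toBlocks₂₂ - B.toBlocks₁₂)⁻¹ * (B.toBlocks₁₁ - B.toBlocks₂₁))⁻¹) B :=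
  ContinuousAt.comp (g := fun X : Matrix ι ι R => X⁻¹)
    (f := fun B : Matrix (ι ⊕ ι) (ι ⊕ ι) R => (B.toBlocks₂₂ - B.toBlocks₁₂)⁻¹ * (B.toBlocks₁₁ - B.toBlocks₂₁))
    (continuousAt_inv_of_isUnit hinv _ hA) (continuousAt_mainOrbitBlock hinv B hM)

end MatrixLevel

/-! ## §2 The chart `m(P, A) = P · ι(A, 1)`: matrix, injectivity, coordinates on `Ω`, range -/

section Chart

/-- the matrix of `P · ι(A, 1)` is `P · fromBlocks A 0 0 1`. [cite: GelbartPiatetskishapiroRallis1987, Part A §1] -/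
theorem coe_mul_blockDiag_one (P : unitaryGroupOfForm σ (fromBlocks J 0 0 (-J))) (A : unitaryGroupOfForm σ J) :
    (((P * blockDiag σ J (-J) (A, 1) : unitaryGroupOfForm σ (fromBlocks J 0 0 (-J))) : GL (ι ⊕ ι) R) : Matrix (ι ⊕ ι) (ι ⊕ ι) R) =
      ((P : GL (ι ⊕ ι) R) : Matrix (ι ⊕ ι) (ι ⊕ ι) R) * fromBlocks ((A : GL ι R) : Matrix ι ι R) 0 0 1 := by
  rw [Subgroup.coe_mul, Units.val_mul, coe_blockDiag]
  rfl

/-- the matrix of an element of `H = U(J ⊕ −J)` is an isometry of `J ⊕ −J`. [folklore] -/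
theorem isometry_coe (B : unitaryGroupOfForm σ (fromBlocks J 0 0 (-J))) :
    (((B : GL (ι ⊕ ι) R) : Matrix (ι ⊕ ι) (ι ⊕ ι) R).map σ)ᵀ * fromBlocks J 0 0 (-J) * ((B : GL (ι ⊕ ι) R) : Matrix (ι ⊕ ι) (ι ⊕ ι) R) =
      fromBlocks J 0 0 (-J) :=
  mem_unitaryGroupOfForm_iff.1 B.2

/-- `M(P)` is a unit for `P ∈ P_Δ` (`P·P⁻¹ = 1` in `H`, ★ `isUnit_toBlocks_sub_of_siegel_mul_eq_one`). [cite: GelbartPiatetskishapiroRallis1987, Part A §1] -/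
theorem isUnit_toBlocks_sub_of_siegel (P : unitaryGroupOfForm σ (fromBlocks J 0 0 (-J)))
    (hP : ((P : GL (ι ⊕ ι) R) : Matrix (ι ⊕ ι) (ι ⊕ ι) R).toBlocks₁₁ + ((P : GL (ι ⊕ ι) R) : Matrix (ι ⊕ ι) (ι ⊕ ι) R).toBlocks₁₂ =
      ((P : GL (ι ⊕ ι) R) : Matrix (ι ⊕ ι) (ι ⊕ ι) R).toBlocks₂₁ + ((P : GL (ι ⊕ ι) R) : Matrix (ι ⊕ ι) (ι ⊕ ι) R).toBlocks₂₂) :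
    IsUnit (((P : GL (ι ⊕ ι) R) : Matrix (ι ⊕ ι) (ι ⊕ ι) R).toBlocks₂₂ - ((P : GL (ι ⊕ ι) R) : Matrix (ι ⊕ ι) (ι ⊕ ι) R).toBlocks₁₂) :=
  isUnit_toBlocks_sub_of_siegel_mul_eq_one _ (((P : GL (ι ⊕ ι) R)⁻¹ : GL (ι ⊕ ι) R) : Matrix (ι ⊕ ι) (ι ⊕ ι) R) hP
    (by rw [← Units.val_mul, mul_inv_cancel, Units.val_one])

/-- **`M(P·ι(A,1)) = M(P)` is a unit**: the chart lands in the main orbit `Ω = {M unit}`. [cite: GelbartPiatetskishapiroRallis1987, Part A §1] -/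
theorem isUnit_toBlocks_sub_mul_blockDiag_one
    (px : {P : unitaryGroupOfForm σ (fromBlocks J 0 0 (-J)) //
        ((P : GL (ι ⊕ ι) R) : Matrix (ι ⊕ ι) (ι ⊕ ι) R).toBlocks₁₁ + ((P : GL (ι ⊕ ι) R) : Matrix (ι ⊕ ι) (ι ⊕ ι) R).toBlocks₁₂ =
          ((P : GL (ι ⊕ ι) R) : Matrix (ι ⊕ ι) (ι ⊕ ι) R).toBlocks₂₁ + ((P : GL (ι ⊕ ι) R) : Matrix (ι ⊕ ι) (ι ⊕ ι) R).toBlocks₂₂} ×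
      unitaryGroupOfForm σ J) :
    IsUnit ((((px.1.1 * blockDiag σ J (-J) (px.2, 1) : unitaryGroupOfForm σ (fromBlocks J 0 0 (-J))) : GL (ι ⊕ ι) R) :
        Matrix (ι ⊕ ι) (ι ⊕ ι) R).toBlocks₂₂ -
      (((px.1.1 * blockDiag σ J (-J) (px.2, 1) : unitaryGroupOfForm σ (fromBlocks J 0 0 (-J))) : GL (ι ⊕ ι) R) :
        Matrix (ι ⊕ ι) (ι ⊕ ι) R).toBlocks₁₂) := by
  rw [coe_mul_blockDiag_one]
  exact isUnit_toBlocks_sub_siegel_mul_iota _ (isUnit_toBlocks_sub_of_siegel σ J px.1.1 px.1.2) _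

/-- **INJECTIVITY of the chart** `(P, A) ↦ P·ι(A,1)` on `P_Δ × G` (★ `siegel_mul_iota_unique_ring`).
[cite: GelbartPiatetskishapiroRallis1987, Part A §1 (stabiliser `G^Δ`)] [cite: Liu2021, Lem. B.11] -/
theorem siegel_mul_blockDiag_injective :
    Function.Injective fun px : {P : unitaryGroupOfForm σ (fromBlocks J 0 0 (-J)) //
        ((P : GL (ι ⊕ ι) R) : Matrix (ι ⊕ ι) (ι ⊕ ι) R).toBlocks₁₁ + ((P : GL (ι ⊕ ι) R) : Matrix (ι ⊕ ι) (ι ⊕ ι) R).toBlocks₁₂ =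
          ((P : GL (ι ⊕ ι) R) : Matrix (ι ⊕ ι) (ι ⊕ ι) R).toBlocks₂₁ + ((P : GL (ι ⊕ ι) R) : Matrix (ι ⊕ ι) (ι ⊕ ι) R).toBlocks₂₂} ×
      unitaryGroupOfForm σ J => (px.1.1 : unitaryGroupOfForm σ (fromBlocks J 0 0 (-J))) * blockDiag σ J (-J) (px.2, 1) := by
  rintro ⟨⟨P, hP⟩, A⟩ ⟨⟨P', hP'⟩, A'⟩ h
  have hmat := congrArg (fun B : unitaryGroupOfForm σ (fromBlocks J 0 0 (-J)) => ((B : GL (ι ⊕ ι) R) : Matrix (ι ⊕ ι) (ι ⊕ ι) R)) h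
  simp only [coe_mul_blockDiag_one] at hmat
  obtain ⟨hAA, hPP⟩ := siegel_mul_iota_unique_ring hP hP' (isUnit_toBlocks_sub_of_siegel σ J P hP) hmat
  have hA : A = A' := Subtype.ext (Units.ext hAA)
  have hPeq : P = P' := Subtype.ext (Units.ext (hPP (A : GL ι R).isUnit))
  subst hA hPeq
  rfl

variable {σ J}

/-- for `B ∈ Ω` the coordinate `A(B) = M(B)⁻¹(B₁₁ − B₂₁)` has unit determinant (★ `isUnit_mainOrbitBlock_ring`; `det J` a unit). [cite: Liu2021, Lem. B.11 p. 102] -/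
theorem isUnit_det_mainOrbitBlock (hJ : IsUnit J.det) (B : unitaryGroupOfForm σ (fromBlocks J 0 0 (-J)))
    (hM : IsUnit (((B : GL (ι ⊕ ι) R) : Matrix (ι ⊕ ι) (ι ⊕ ι) R).toBlocks₂₂ - ((B : GL (ι ⊕ ι) R) : Matrix (ι ⊕ ι) (ι ⊕ ι) R).toBlocks₁₂)) :
    IsUnit ((((B : GL (ι ⊕ ι) R) : Matrix (ι ⊕ ι) (ι ⊕ ι) R).toBlocks₂₂ - ((B : GL (ι ⊕ ι) R) : Matrix (ι ⊕ ι) (ι ⊕ ι) R).toBlocks₁₂)⁻¹ *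
        (((B : GL (ι ⊕ ι) R) : Matrix (ι ⊕ ι) (ι ⊕ ι) R).toBlocks₁₁ - ((B : GL (ι ⊕ ι) R) : Matrix (ι ⊕ ι) (ι ⊕ ι) R).toBlocks₂₁)).det :=
  (isUnit_iff_isUnit_det _).1 (isUnit_mainOrbitBlock_ring σ hJ _ (isometry_coe σ J B) hM)

/-- **the `G`-coordinate of `B ∈ Ω`**: the unit `A(B)` (`Matrix.nonsingInvUnit`) lies in `G = U(J)` (★ `unitary_mainOrbitBlock_ring`).
[cite: Liu2021, §B.3 (B.5) p. 101] [cite: GelbartPiatetskishapiroRallis1987, Part A §1] -/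
theorem nonsingInvUnit_mainOrbitBlock_mem (hJ : IsUnit J.det) (B : unitaryGroupOfForm σ (fromBlocks J 0 0 (-J)))
    (hM : IsUnit (((B : GL (ι ⊕ ι) R) : Matrix (ι ⊕ ι) (ι ⊕ ι) R).toBlocks₂₂ - ((B : GL (ι ⊕ ι) R) : Matrix (ι ⊕ ι) (ι ⊕ ι) R).toBlocks₁₂)) :
    Matrix.nonsingInvUnit _ (isUnit_det_mainOrbitBlock hJ B hM) ∈ unitaryGroupOfForm σ J :=
  mem_unitaryGroupOfForm_iff.2 (unitary_mainOrbitBlock_ring σ J _ (isometry_coe σ J B) hM)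

/-- the matrix of the `P_Δ`-coordinate `B · ι(A(B), 1)⁻¹` is `B · fromBlocks A(B)⁻¹ 0 0 1`. [cite: Liu2021, Lem. B.11 p. 102] -/
theorem coe_mul_blockDiag_inv (hJ : IsUnit J.det) (B : unitaryGroupOfForm σ (fromBlocks J 0 0 (-J)))
    (hM : IsUnit (((B : GL (ι ⊕ ι) R) : Matrix (ι ⊕ ι) (ι ⊕ ι) R).toBlocks₂₂ - ((B : GL (ι ⊕ ι) R) : Matrix (ι ⊕ ι) (ι ⊕ ι) R).toBlocks₁₂)) :
    (((B * blockDiag σ J (-J) ((⟨_, nonsingInvUnit_mainOrbitBlock_mem hJ B hM⟩ : unitaryGroupOfForm σ J)⁻¹, 1) :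
          unitaryGroupOfForm σ (fromBlocks J 0 0 (-J))) : GL (ι ⊕ ι) R) : Matrix (ι ⊕ ι) (ι ⊕ ι) R) =
      ((B : GL (ι ⊕ ι) R) : Matrix (ι ⊕ ι) (ι ⊕ ι) R) *
        fromBlocks ((((B : GL (ι ⊕ ι) R) : Matrix (ι ⊕ ι) (ι ⊕ ι) R).toBlocks₂₂ - ((B : GL (ι ⊕ ι) R) : Matrix (ι ⊕ ι) (ι ⊕ ι) R).toBlocks₁₂)⁻¹ *
          (((B : GL (ι ⊕ ι) R) : Matrix (ι ⊕ ι) (ι ⊕ ι) R).toBlocks₁₁ - ((B : GL (ι ⊕ ι) R) : Matrix (ι ⊕ ι) (ι ⊕ ι) R).toBlocks₂₁))⁻¹ 0 0 1 := by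
  rw [coe_mul_blockDiag_one]
  rfl

/-- **the `P_Δ`-coordinate `B · ι(A(B), 1)⁻¹` of `B ∈ Ω` is Siegel** (★ `siegel_of_mainOrbit_block_ring`). [cite: Liu2021, Lem. B.11 p. 102] -/
theorem siegel_mul_blockDiag_inv (hJ : IsUnit J.det) (B : unitaryGroupOfForm σ (fromBlocks J 0 0 (-J)))
    (hM : IsUnit (((B : GL (ι ⊕ ι) R) : Matrix (ι ⊕ ι) (ι ⊕ ι) R).toBlocks₂₂ - ((B : GL (ι ⊕ ι) R) : Matrix (ι ⊕ ι) (ι ⊕ ι) R).toBlocks₁₂)) :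
    (((B * blockDiag σ J (-J) ((⟨_, nonsingInvUnit_mainOrbitBlock_mem hJ B hM⟩ : unitaryGroupOfForm σ J)⁻¹, 1) :
            unitaryGroupOfForm σ (fromBlocks J 0 0 (-J))) : GL (ι ⊕ ι) R) : Matrix (ι ⊕ ι) (ι ⊕ ι) R).toBlocks₁₁ +
        (((B * blockDiag σ J (-J) ((⟨_, nonsingInvUnit_mainOrbitBlock_mem hJ B hM⟩ : unitaryGroupOfForm σ J)⁻¹, 1) :
            unitaryGroupOfForm σ (fromBlocks J 0 0 (-J))) : GL (ι ⊕ ι) R) : Matrix (ι ⊕ ι) (ι ⊕ ι) R).toBlocks₁₂ =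
      (((B * blockDiag σ J (-J) ((⟨_, nonsingInvUnit_mainOrbitBlock_mem hJ B hM⟩ : unitaryGroupOfForm σ J)⁻¹, 1) :
            unitaryGroupOfForm σ (fromBlocks J 0 0 (-J))) : GL (ι ⊕ ι) R) : Matrix (ι ⊕ ι) (ι ⊕ ι) R).toBlocks₂₁ +
        (((B * blockDiag σ J (-J) ((⟨_, nonsingInvUnit_mainOrbitBlock_mem hJ B hM⟩ : unitaryGroupOfForm σ J)⁻¹, 1) :
            unitaryGroupOfForm σ (fromBlocks J 0 0 (-J))) : GL (ι ⊕ ι) R) : Matrix (ι ⊕ ι) (ι ⊕ ι) R).toBlocks₂₂ := by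
  rw [coe_mul_blockDiag_inv hJ B hM]
  exact siegel_of_mainOrbit_block_ring _ (isUnit_mainOrbitBlock_ring σ hJ _ (isometry_coe σ J B) hM)
    (exists_siegel_mul_iota_iff_isUnit_ring.sub_eq_toBlocks_sub_mul_mainOrbitBlock_ring _ hM)

/-- **the chart hits every `B ∈ Ω`**: `(B · ι(A(B),1)⁻¹) · ι(A(B), 1) = B`. [cite: Liu2021, Lem. B.11 p. 102] -/
theorem mul_blockDiag_inv_mul_blockDiag (hJ : IsUnit J.det) (B : unitaryGroupOfForm σ (fromBlocks J 0 0 (-J)))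
    (hM : IsUnit (((B : GL (ι ⊕ ι) R) : Matrix (ι ⊕ ι) (ι ⊕ ι) R).toBlocks₂₂ - ((B : GL (ι ⊕ ι) R) : Matrix (ι ⊕ ι) (ι ⊕ ι) R).toBlocks₁₂)) :
    B * blockDiag σ J (-J) ((⟨_, nonsingInvUnit_mainOrbitBlock_mem hJ B hM⟩ : unitaryGroupOfForm σ J)⁻¹, 1) *
        blockDiag σ J (-J) ((⟨_, nonsingInvUnit_mainOrbitBlock_mem hJ B hM⟩ : unitaryGroupOfForm σ J), 1) = B := by
  rw [mul_assoc, ← map_mul, Prod.mk_mul_mk, inv_mul_cancel, mul_one, ← Prod.one_eq_mk, map_one, mul_one]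

/-- **THE RANGE OF THE CHART IS THE MAIN ORBIT**: `{P·ι(A,1)} = Ω = {B : H | M(B) unit}` (`det J` a unit).
[cite: GelbartPiatetskishapiroRallis1987, Part A §1] [cite: Liu2021, §B.3 (B.5), Lem. B.11] -/
theorem range_siegel_mul_blockDiag (hJ : IsUnit J.det) :
    Set.range (fun px : {P : unitaryGroupOfForm σ (fromBlocks J 0 0 (-J)) //
        ((P : GL (ι ⊕ ι) R) : Matrix (ι ⊕ ι) (ι ⊕ ι) R).toBlocks₁₁ + ((P : GL (ι ⊕ ι) R) : Matrix (ι ⊕ ι) (ι ⊕ ι) R).toBlocks₁₂ =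
          ((P : GL (ι ⊕ ι) R) : Matrix (ι ⊕ ι) (ι ⊕ ι) R).toBlocks₂₁ + ((P : GL (ι ⊕ ι) R) : Matrix (ι ⊕ ι) (ι ⊕ ι) R).toBlocks₂₂} ×
      unitaryGroupOfForm σ J => (px.1.1 : unitaryGroupOfForm σ (fromBlocks J 0 0 (-J))) * blockDiag σ J (-J) (px.2, 1)) =
      {B : unitaryGroupOfForm σ (fromBlocks J 0 0 (-J)) |
        IsUnit (((B : GL (ι ⊕ ι) R) : Matrix (ι ⊕ ι) (ι ⊕ ι) R).toBlocks₂₂ - ((B : GL (ι ⊕ ι) R) : Matrix (ι ⊕ ι) (ι ⊕ ι) R).toBlocks₁₂)} := by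
  ext B
  constructor
  · rintro ⟨px, rfl⟩
    exact isUnit_toBlocks_sub_mul_blockDiag_one σ J px
  · intro hM
    exact ⟨(⟨_, siegel_mul_blockDiag_inv hJ B hM⟩, ⟨_, nonsingInvUnit_mainOrbitBlock_mem hJ B hM⟩), mul_blockDiag_inv_mul_blockDiag hJ B hM⟩

/-- the inverse chart is a two-sided inverse: `B ↦ (B·ι(A(B),1)⁻¹, A(B))` recovers `(P, A)` from `P·ι(A,1)` (injectivity).
[cite: GelbartPiatetskishapiroRallis1987, Part A §1] -/
theorem siegelFactor_mainOrbitBlockUnit_apply (hJ : IsUnit J.det)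
    (px : {P : unitaryGroupOfForm σ (fromBlocks J 0 0 (-J)) //
        ((P : GL (ι ⊕ ι) R) : Matrix (ι ⊕ ι) (ι ⊕ ι) R).toBlocks₁₁ + ((P : GL (ι ⊕ ι) R) : Matrix (ι ⊕ ι) (ι ⊕ ι) R).toBlocks₁₂ =
          ((P : GL (ι ⊕ ι) R) : Matrix (ι ⊕ ι) (ι ⊕ ι) R).toBlocks₂₁ + ((P : GL (ι ⊕ ι) R) : Matrix (ι ⊕ ι) (ι ⊕ ι) R).toBlocks₂₂} ×
      unitaryGroupOfForm σ J)
    (hM : IsUnit ((((px.1.1 * blockDiag σ J (-J) (px.2, 1) : unitaryGroupOfForm σ (fromBlocks J 0 0 (-J))) : GL (ι ⊕ ι) R) :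
        Matrix (ι ⊕ ι) (ι ⊕ ι) R).toBlocks₂₂ -
      (((px.1.1 * blockDiag σ J (-J) (px.2, 1) : unitaryGroupOfForm σ (fromBlocks J 0 0 (-J))) : GL (ι ⊕ ι) R) :
        Matrix (ι ⊕ ι) (ι ⊕ ι) R).toBlocks₁₂)) :
    ((⟨(px.1.1 * blockDiag σ J (-J) (px.2, 1)) *
          blockDiag σ J (-J) ((⟨_, nonsingInvUnit_mainOrbitBlock_mem hJ _ hM⟩ : unitaryGroupOfForm σ J)⁻¹, 1),
        siegel_mul_blockDiag_inv hJ _ hM⟩,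
      (⟨_, nonsingInvUnit_mainOrbitBlock_mem hJ _ hM⟩ : unitaryGroupOfForm σ J)) :
      {P : unitaryGroupOfForm σ (fromBlocks J 0 0 (-J)) //
        ((P : GL (ι ⊕ ι) R) : Matrix (ι ⊕ ι) (ι ⊕ ι) R).toBlocks₁₁ + ((P : GL (ι ⊕ ι) R) : Matrix (ι ⊕ ι) (ι ⊕ ι) R).toBlocks₁₂ =
          ((P : GL (ι ⊕ ι) R) : Matrix (ι ⊕ ι) (ι ⊕ ι) R).toBlocks₂₁ + ((P : GL (ι ⊕ ι) R) : Matrix (ι ⊕ ι) (ι ⊕ ι) R).toBlocks₂₂} ×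
      unitaryGroupOfForm σ J) = px :=
  siegel_mul_blockDiag_injective σ J (mul_blockDiag_inv_mul_blockDiag hJ _ hM)

end Chart

/-! ## §3 Topology: `Ω` open, the coordinates continuous on `Ω`, the chart an open embedding -/

section TopologySec

variable [TopologicalSpace R] [IsTopologicalRing R]

/-- `B ↦ M(B)` is continuous on `H`. [folklore] -/
theorem continuous_toBlocks_sub_coe :
    Continuous fun B : unitaryGroupOfForm σ (fromBlocks J 0 0 (-J)) =>
      ((B : GL (ι ⊕ ι) R) : Matrix (ι ⊕ ι) (ι ⊕ ι) R).toBlocks₂₂ - ((B : GL (ι ⊕ ι) R) : Matrix (ι ⊕ ι) (ι ⊕ ι) R).toBlocks₁₂ :=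
  continuous_toBlocks_sub.comp (Units.continuous_val.comp continuous_subtype_val)

/-- **`Ω = {B : H | M(B) unit}` is OPEN** when the units of `R` form an open set (preimage of `Rˣ` under `B ↦ det M(B)`).
[cite: GelbartPiatetskishapiroRallis1987, Part A §1 (the main orbit is open)] -/
theorem isOpen_setOf_isUnit_mainOrbitBlock (hU : IsOpen {x : R | IsUnit x}) :
    IsOpen {B : unitaryGroupOfForm σ (fromBlocks J 0 0 (-J)) |
      IsUnit (((B : GL (ι ⊕ ι) R) : Matrix (ι ⊕ ι) (ι ⊕ ι) R).toBlocks₂₂ - ((B : GL (ι ⊕ ι) R) : Matrix (ι ⊕ ι) (ι ⊕ ι) R).toBlocks₁₂)} := by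
  have h : {B : unitaryGroupOfForm σ (fromBlocks J 0 0 (-J)) |
      IsUnit (((B : GL (ι ⊕ ι) R) : Matrix (ι ⊕ ι) (ι ⊕ ι) R).toBlocks₂₂ - ((B : GL (ι ⊕ ι) R) : Matrix (ι ⊕ ι) (ι ⊕ ι) R).toBlocks₁₂)} =
      (fun B : unitaryGroupOfForm σ (fromBlocks J 0 0 (-J)) =>
        (((B : GL (ι ⊕ ι) R) : Matrix (ι ⊕ ι) (ι ⊕ ι) R).toBlocks₂₂ - ((B : GL (ι ⊕ ι) R) : Matrix (ι ⊕ ι) (ι ⊕ ι) R).toBlocks₁₂).det) ⁻¹'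
        {x : R | IsUnit x} := by
    ext B
    exact isUnit_iff_isUnit_det _
  rw [h]
  exact hU.preimage (continuous_toBlocks_sub_coe σ J).matrix_det

variable {σ J}

/-- **the `G`-coordinate `B ↦ A(B)` is CONTINUOUS on `Ω`** (into `G ≤ GL_ι(R)` with its `Units` topology: both `A(B)` and `A(B)⁻¹` vary continuously).
[cite: Liu2021, Lem. B.11 p. 102] -/
theorem continuous_mainOrbitBlockUnit (hJ : IsUnit J.det) (hinv : ∀ x : R, IsUnit x → ContinuousAt Ring.inverse x) :
    Continuous fun b : {B : unitaryGroupOfForm σ (fromBlocks J 0 0 (-J)) //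
        IsUnit (((B : GL (ι ⊕ ι) R) : Matrix (ι ⊕ ι) (ι ⊕ ι) R).toBlocks₂₂ - ((B : GL (ι ⊕ ι) R) : Matrix (ι ⊕ ι) (ι ⊕ ι) R).toBlocks₁₂)} =>
      (⟨_, nonsingInvUnit_mainOrbitBlock_mem hJ b.1 b.2⟩ : unitaryGroupOfForm σ J) := by
  have hcoe : Continuous fun b : {B : unitaryGroupOfForm σ (fromBlocks J 0 0 (-J)) //
      IsUnit (((B : GL (ι ⊕ ι) R) : Matrix (ι ⊕ ι) (ι ⊕ ι) R).toBlocks₂₂ - ((B : GL (ι ⊕ ι) R) : Matrix (ι ⊕ ι) (ι ⊕ ι) R).toBlocks₁₂)} =>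
      ((b.1 : GL (ι ⊕ ι) R) : Matrix (ι ⊕ ι) (ι ⊕ ι) R) :=
    Units.continuous_val.comp (continuous_subtype_val.comp continuous_subtype_val)
  refine Continuous.subtype_mk (Units.continuous_iff.2 ⟨?_, ?_⟩) _
  · exact continuous_iff_continuousAt.2 fun b =>
      ContinuousAt.comp (g := fun B : Matrix (ι ⊕ ι) (ι ⊕ ι) R => (B.toBlocks₂₂ - B.toBlocks₁₂)⁻¹ * (B.toBlocks₁₁ - B.toBlocks₂₁))
        (f := fun b : {B : unitaryGroupOfForm σ (fromBlocks J 0 0 (-J)) //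
          IsUnit (((B : GL (ι ⊕ ι) R) : Matrix (ι ⊕ ι) (ι ⊕ ι) R).toBlocks₂₂ - ((B : GL (ι ⊕ ι) R) : Matrix (ι ⊕ ι) (ι ⊕ ι) R).toBlocks₁₂)} =>
          ((b.1 : GL (ι ⊕ ι) R) : Matrix (ι ⊕ ι) (ι ⊕ ι) R))
        (continuousAt_mainOrbitBlock hinv _ b.2) hcoe.continuousAt
  · exact continuous_iff_continuousAt.2 fun b =>
      ContinuousAt.comp (g := fun B : Matrix (ι ⊕ ι) (ι ⊕ ι) R => ((B.toBlocks₂₂ - B.toBlocks₁₂)⁻¹ * (B.toBlocks₁₁ - B.toBlocks₂₁))⁻¹)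
        (f := fun b : {B : unitaryGroupOfForm σ (fromBlocks J 0 0 (-J)) //
          IsUnit (((B : GL (ι ⊕ ι) R) : Matrix (ι ⊕ ι) (ι ⊕ ι) R).toBlocks₂₂ - ((B : GL (ι ⊕ ι) R) : Matrix (ι ⊕ ι) (ι ⊕ ι) R).toBlocks₁₂)} =>
          ((b.1 : GL (ι ⊕ ι) R) : Matrix (ι ⊕ ι) (ι ⊕ ι) R))
        (continuousAt_mainOrbitBlock_inv hinv _ b.2 (isUnit_mainOrbitBlock_ring σ hJ _ (isometry_coe σ J b.1) b.2)) hcoe.continuousAt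

/-- **the `P_Δ`-coordinate `B ↦ B · ι(A(B), 1)⁻¹` is CONTINUOUS on `Ω`.** [cite: Liu2021, Lem. B.11 p. 102] -/
theorem continuous_siegelFactor (hJ : IsUnit J.det) (hinv : ∀ x : R, IsUnit x → ContinuousAt Ring.inverse x) :
    Continuous fun b : {B : unitaryGroupOfForm σ (fromBlocks J 0 0 (-J)) //
        IsUnit (((B : GL (ι ⊕ ι) R) : Matrix (ι ⊕ ι) (ι ⊕ ι) R).toBlocks₂₂ - ((B : GL (ι ⊕ ι) R) : Matrix (ι ⊕ ι) (ι ⊕ ι) R).toBlocks₁₂)} =>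
      (⟨b.1 * blockDiag σ J (-J) ((⟨_, nonsingInvUnit_mainOrbitBlock_mem hJ b.1 b.2⟩ : unitaryGroupOfForm σ J)⁻¹, 1),
          siegel_mul_blockDiag_inv hJ b.1 b.2⟩ :
        {P : unitaryGroupOfForm σ (fromBlocks J 0 0 (-J)) //
          ((P : GL (ι ⊕ ι) R) : Matrix (ι ⊕ ι) (ι ⊕ ι) R).toBlocks₁₁ + ((P : GL (ι ⊕ ι) R) : Matrix (ι ⊕ ι) (ι ⊕ ι) R).toBlocks₁₂ =
            ((P : GL (ι ⊕ ι) R) : Matrix (ι ⊕ ι) (ι ⊕ ι) R).toBlocks₂₁ + ((P : GL (ι ⊕ ι) R) : Matrix (ι ⊕ ι) (ι ⊕ ι) R).toBlocks₂₂}) :=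
  Continuous.subtype_mk (continuous_subtype_val.mul
    ((continuous_blockDiag σ J (-J)).comp (((continuous_mainOrbitBlockUnit hJ hinv).inv).prodMk continuous_const))) _

/-- **THE MAIN-ORBIT CHART IS AN OPEN EMBEDDING**: `(P, A) ↦ P·ι(A,1) : P_Δ × G → H = U(J ⊕ −J)` is continuous, injective and open,
with range `Ω = {M unit}` — for `det J` a unit, the units of `R` open and `Ring.inverse` continuous at them.
[cite: GelbartPiatetskishapiroRallis1987, Part A §1] [cite: Liu2021, §B.3 (B.5), Lem. B.11] [cite: HarrisKudlaSweet1996, §1 (1.11)–(1.12)] -/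
theorem isOpenEmbedding_siegel_mul_blockDiag (hJ : IsUnit J.det) (hU : IsOpen {x : R | IsUnit x})
    (hinv : ∀ x : R, IsUnit x → ContinuousAt Ring.inverse x) :
    IsOpenEmbedding fun px : {P : unitaryGroupOfForm σ (fromBlocks J 0 0 (-J)) //
        ((P : GL (ι ⊕ ι) R) : Matrix (ι ⊕ ι) (ι ⊕ ι) R).toBlocks₁₁ + ((P : GL (ι ⊕ ι) R) : Matrix (ι ⊕ ι) (ι ⊕ ι) R).toBlocks₁₂ =
          ((P : GL (ι ⊕ ι) R) : Matrix (ι ⊕ ι) (ι ⊕ ι) R).toBlocks₂₁ + ((P : GL (ι ⊕ ι) R) : Matrix (ι ⊕ ι) (ι ⊕ ι) R).toBlocks₂₂} ×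
      unitaryGroupOfForm σ J => (px.1.1 : unitaryGroupOfForm σ (fromBlocks J 0 0 (-J))) * blockDiag σ J (-J) (px.2, 1) := by
  refine IsOpenEmbedding.of_continuous_injective_isOpenMap ?_ (siegel_mul_blockDiag_injective σ J) ?_
  · exact (continuous_subtype_val.comp continuous_fst).mul
      ((continuous_blockDiag σ J (-J)).comp (continuous_snd.prodMk continuous_const))
  · -- the chart factors as a HOMEOMORPHISM `P_Δ × G ≃ₜ Ω` followed by the open inclusion `Ω ⊆ H`
    have hΩ := isOpen_setOf_isUnit_mainOrbitBlock σ J hU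
    let e : ({P : unitaryGroupOfForm σ (fromBlocks J 0 0 (-J)) //
          ((P : GL (ι ⊕ ι) R) : Matrix (ι ⊕ ι) (ι ⊕ ι) R).toBlocks₁₁ + ((P : GL (ι ⊕ ι) R) : Matrix (ι ⊕ ι) (ι ⊕ ι) R).toBlocks₁₂ =
            ((P : GL (ι ⊕ ι) R) : Matrix (ι ⊕ ι) (ι ⊕ ι) R).toBlocks₂₁ + ((P : GL (ι ⊕ ι) R) : Matrix (ι ⊕ ι) (ι ⊕ ι) R).toBlocks₂₂} ×
          unitaryGroupOfForm σ J) ≃ₜ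
        {B : unitaryGroupOfForm σ (fromBlocks J 0 0 (-J)) //
          IsUnit (((B : GL (ι ⊕ ι) R) : Matrix (ι ⊕ ι) (ι ⊕ ι) R).toBlocks₂₂ - ((B : GL (ι ⊕ ι) R) : Matrix (ι ⊕ ι) (ι ⊕ ι) R).toBlocks₁₂)} :=
      { toFun := fun px => ⟨(px.1.1 : unitaryGroupOfForm σ (fromBlocks J 0 0 (-J))) * blockDiag σ J (-J) (px.2, 1),
          isUnit_toBlocks_sub_mul_blockDiag_one σ J px⟩
        invFun := fun b =>
          (⟨b.1 * blockDiag σ J (-J) ((⟨_, nonsingInvUnit_mainOrbitBlock_mem hJ b.1 b.2⟩ : unitaryGroupOfForm σ J)⁻¹, 1),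
              siegel_mul_blockDiag_inv hJ b.1 b.2⟩,
            (⟨_, nonsingInvUnit_mainOrbitBlock_mem hJ b.1 b.2⟩ : unitaryGroupOfForm σ J))
        left_inv := fun px => siegelFactor_mainOrbitBlockUnit_apply hJ px (isUnit_toBlocks_sub_mul_blockDiag_one σ J px)
        right_inv := fun b => Subtype.ext (mul_blockDiag_inv_mul_blockDiag hJ b.1 b.2)
        continuous_toFun := ((continuous_subtype_val.comp continuous_fst).mul
          ((continuous_blockDiag σ J (-J)).comp (continuous_snd.prodMk continuous_const))).subtype_mk _
        continuous_invFun := (continuous_siegelFactor hJ hinv).prodMk (continuous_mainOrbitBlockUnit hJ hinv) }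
    exact (hΩ.isOpenEmbedding_subtypeVal.comp e.isOpenEmbedding).isOpenMap

end TopologySec

/-! ## §4 (D1) `P_Δ · ι(C, 1)` is closed for `C` compact (Hausdorff coefficients) -/

section Closed

variable [TopologicalSpace R] [IsTopologicalRing R] [T2Space R]

/-- `P_Δ = {P : H | P₁₁ + P₁₂ = P₂₁ + P₂₂}` is CLOSED in `H` (a level set of continuous block sums). [cite: GelbartPiatetskishapiroRallis1987, Part A §1] -/
theorem isClosed_setOf_siegel :
    IsClosed {P : unitaryGroupOfForm σ (fromBlocks J 0 0 (-J)) |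
      ((P : GL (ι ⊕ ι) R) : Matrix (ι ⊕ ι) (ι ⊕ ι) R).toBlocks₁₁ + ((P : GL (ι ⊕ ι) R) : Matrix (ι ⊕ ι) (ι ⊕ ι) R).toBlocks₁₂ =
        ((P : GL (ι ⊕ ι) R) : Matrix (ι ⊕ ι) (ι ⊕ ι) R).toBlocks₂₁ + ((P : GL (ι ⊕ ι) R) : Matrix (ι ⊕ ι) (ι ⊕ ι) R).toBlocks₂₂} := by
  have hcoe : Continuous fun P : unitaryGroupOfForm σ (fromBlocks J 0 0 (-J)) => ((P : GL (ι ⊕ ι) R) : Matrix (ι ⊕ ι) (ι ⊕ ι) R) :=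
    Units.continuous_val.comp continuous_subtype_val
  exact isClosed_eq ((continuous_toBlocks.1.comp hcoe).add (continuous_toBlocks.2.1.comp hcoe))
    ((continuous_toBlocks.2.2.1.comp hcoe).add (continuous_toBlocks.2.2.2.comp hcoe))

/-- **(D1) `P_Δ · ι(C, 1)` is CLOSED in `H` for `C ⊆ G` compact**: the image of `P_Δ × C` under the chart is the product set of the closed
subgroup `P_Δ` and the compact set `ι(C, 1)` (`IsClosed.mul_right_of_isCompact`).  Independent of §3.
[cite: GelbartPiatetskishapiroRallis1987, Part A §1 (`P\Ω ≅ G`)] -/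
theorem isClosed_siegel_mul_blockDiag_image_of_isCompact {C : Set (unitaryGroupOfForm σ J)} (hC : IsCompact C) :
    IsClosed ((fun px : {P : unitaryGroupOfForm σ (fromBlocks J 0 0 (-J)) //
        ((P : GL (ι ⊕ ι) R) : Matrix (ι ⊕ ι) (ι ⊕ ι) R).toBlocks₁₁ + ((P : GL (ι ⊕ ι) R) : Matrix (ι ⊕ ι) (ι ⊕ ι) R).toBlocks₁₂ =
          ((P : GL (ι ⊕ ι) R) : Matrix (ι ⊕ ι) (ι ⊕ ι) R).toBlocks₂₁ + ((P : GL (ι ⊕ ι) R) : Matrix (ι ⊕ ι) (ι ⊕ ι) R).toBlocks₂₂} ×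
      unitaryGroupOfForm σ J => (px.1.1 : unitaryGroupOfForm σ (fromBlocks J 0 0 (-J))) * blockDiag σ J (-J) (px.2, 1)) '' (Set.univ ×ˢ C)) := by
  have hset : (fun px : {P : unitaryGroupOfForm σ (fromBlocks J 0 0 (-J)) //
        ((P : GL (ι ⊕ ι) R) : Matrix (ι ⊕ ι) (ι ⊕ ι) R).toBlocks₁₁ + ((P : GL (ι ⊕ ι) R) : Matrix (ι ⊕ ι) (ι ⊕ ι) R).toBlocks₁₂ =
          ((P : GL (ι ⊕ ι) R) : Matrix (ι ⊕ ι) (ι ⊕ ι) R).toBlocks₂₁ + ((P : GL (ι ⊕ ι) R) : Matrix (ι ⊕ ι) (ι ⊕ ι) R).toBlocks₂₂} ×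
      unitaryGroupOfForm σ J => (px.1.1 : unitaryGroupOfForm σ (fromBlocks J 0 0 (-J))) * blockDiag σ J (-J) (px.2, 1)) '' (Set.univ ×ˢ C) =
      {P : unitaryGroupOfForm σ (fromBlocks J 0 0 (-J)) |
        ((P : GL (ι ⊕ ι) R) : Matrix (ι ⊕ ι) (ι ⊕ ι) R).toBlocks₁₁ + ((P : GL (ι ⊕ ι) R) : Matrix (ι ⊕ ι) (ι ⊕ ι) R).toBlocks₁₂ =
          ((P : GL (ι ⊕ ι) R) : Matrix (ι ⊕ ι) (ι ⊕ ι) R).toBlocks₂₁ + ((P : GL (ι ⊕ ι) R) : Matrix (ι ⊕ ι) (ι ⊕ ι) R).toBlocks₂₂} *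
        ((fun A : unitaryGroupOfForm σ J => blockDiag σ J (-J) (A, 1)) '' C) := by
    ext B
    simp only [Set.mem_image, Set.mem_prod, Set.mem_univ, true_and, Set.mem_mul, Set.mem_setOf_eq]
    constructor
    · rintro ⟨px, hpx, rfl⟩
      exact ⟨px.1.1, px.1.2, _, ⟨px.2, hpx, rfl⟩, rfl⟩
    · rintro ⟨P, hP, _, ⟨A, hA, rfl⟩, rfl⟩
      exact ⟨(⟨P, hP⟩, A), hA, rfl⟩
  rw [hset]
  exact (isClosed_setOf_siegel σ J).mul_right_of_isCompact
    (hC.image ((continuous_blockDiag σ J (-J)).comp (continuous_id.prodMk continuous_const)))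

end Closed

end Summit.HodgeConjecture.HodgeConjecture.Cruxes.HLiu418.K2LiuSiegelMainOrbitOpenEmbeddingGeneric
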